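import Summits.SmoothPoincare4.SmoothPoincare4.Theorems.CongruenceShadowsShadowApproximationStubLayerStepBlockZeroRealisers
import Summits.SmoothPoincare4.SmoothPoincare4.Theorems.CongruenceShadowsShadowApproximationStubLayerStepBlockZeroMatrix
import HarnessLib

/-!
# Helper for stub `stub_layerStepBlockZero` (line `nilpotent-genus-class`, crux
`CongruenceShadows.ShadowApproximation`, item stmt-SmoothPoincare4-14595):
# elementary Goeritz–Johnson realisers at every genus `3 + 3m ≥ 9` from the genus-`9` base table

`S = SurfaceGroup (3+3m)`, `N i = s4Kernels.stabilizeIter m i`, `γₖ₊₁ = (⊤).lowerCentralSeries k`, `π` the erasing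
projection of the slot-`2` cut pattern (`b_h` cut iff `h ≡ 0 (mod 3)`), readings as in the landed `reading_ia_g`.
THE MECHANISM of the layer step `(m, 0)`: for handles `a < b < c` (not all `≡ 1`, not all `≡ 2 (mod 3)`) the
elementary alternating form `e_{abc}` is the reading of `y = x · bp_{k,k+1} · x⁻¹ ∈ Stab N₀ ∩ Stab N₁`, where `x` (landed
coordinate-pair Goeritz realisation, through `exists_perm_conj_realiser_g`) realises the MATRIX `P_σ (M ⊕ 1)`: `M` a
genus-`9` base matrix whose un-permuted conjugated seed realiser reads as `± e_{ABC}` (a decidable identity on the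
base data, hypothesis `hR`), `M ⊕ 1` its block embedding into the first nine handles (…BlockZeroMatrix), and `σ = τ⁻¹`
a residue-preserving handle permutation with `τ(a, b, c) = (A, B, C)` (`exists_perm_three`).

* §1 `reading_blockEmbed` — the collapsed reading of the block-embedded data is the genus-`9` reading on the first
  nine handles and vanishes beyond: `RD'_N(h₁,h₂,h₃) = ± ẽ_{ABC}(h₁,h₂,h₃)` (`ẽ` the full alternating elementary form);
  `etilde_perm` (transport of `ẽ` along `τ`), `etilde_eq_e3` (on `v < w`, `a < b < c`, `ẽ_{abc}` is the three-term `e_{abc}`).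
* §2 `exists_elementary_realiser` — the realiser of `± e_{abc}` from one base datum; `exists_elementary_realiser_tab`
  — from a table indexed by residue patterns (the trivial realiser on the other triples), the format consumed by the
  genus-`(3+3m)` assembly.
No definitions; the registered helper is `helper_etildePerm`.
-/

set_option linter.dupNamespace false

noncomputable section

open Subgroup Literature.Topology.FourManifolds Literature.Algebra.Lie Multiplicative
open Summit.SmoothPoincare4.SmoothPoincare4.Theorems.NilpotentShadowsStandard.SaturatedTorsorDescent
open scoped commutatorElement

namespace Summit.SmoothPoincare4.SmoothPoincare4.Theorems.ShadowApproximation.NilpotentGenusClass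

/-! ## §1 The collapsed reading of block-embedded data -/

section BlockReading

variable {N : ℕ} (h9 : 9 ≤ N) {M M' : Matrix (Fin 9 × Bool) (Fin 9 × Bool) ℤ} {E E' : Matrix (Fin N × Bool) (Fin N × Bool) ℤ}
  (hE : ∀ p q : Fin N × Bool, E p q = if hp : (p.1 : ℕ) < 9 then (if hq : (q.1 : ℕ) < 9 then
    M (⟨p.1, hp⟩, p.2) (⟨q.1, hq⟩, q.2) else 0) else (if p = q then 1 else 0))
  (hE' : ∀ p q : Fin N × Bool, E' p q = if hp : (p.1 : ℕ) < 9 then (if hq : (q.1 : ℕ) < 9 then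
    M' (⟨p.1, hp⟩, p.2) (⟨q.1, hq⟩, q.2) else 0) else (if p = q then 1 else 0))

include hE hE' in
/-- **The collapsed reading of block-embedded data.**  If the un-permuted collapsed reading of the genus-`9` datum
`(M, M', k)` is `s · ẽ_{ABC}`, then the collapsed reading of the block-embedded datum `(M ⊕ 1, M' ⊕ 1, castLE k, castLE (k+1))`
at handles `h₁, h₂, h₃` of `Fin N` is `s · ẽ_{ABC}` on the embedded handles (and `0` beyond the first nine). [folklore] -/
theorem reading_blockEmbed (k A B C : Fin 9) (s : ℤ)
    (hR : ∀ x y z : Fin 9, (if decide (((x : Fin 9) : ℕ) % 3 = 0) then (-1 : ℤ) else 1) * ((M' ((k : Fin 9), false) (x, decide (((x : Fin 9) : ℕ) % 3 = 0)) * (M (y, !decide (((y : Fin 9) : ℕ) % 3 = 0)) ((k : Fin 9), false) * M (z, !decide (((z : Fin 9) : ℕ) % 3 = 0)) ((k : Fin 9) + 1, true)) + -M' ((k : Fin 9), true) (x, decide (((x : Fin 9) : ℕ) % 3 = 0)) * (M (y, !decide (((y : Fin 9) : ℕ) % 3 = 0)) ((k : Fin 9) + 1, true) * M (z, !decide (((z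 : Fin 9) : ℕ) % 3 = 0)) ((k : Fin 9), true)) + M' ((k : Fin 9) + 1, false) (x, decide (((x : Fin 9) : ℕ) % 3 = 0)) * (M (y, !decide (((y : Fin 9) : ℕ) % 3 = 0)) ((k : Fin 9), true) * M (z, !decide (((z : Fin 9) : ℕ) % 3 = 0)) ((k : Fin 9), false))) - (M' ((k : Fin 9), false) (x, decide (((x : Fin 9) : ℕ) % 3 = 0)) * (M (z, !decide (((z : Fin 9) : ℕ) % 3 = 0)) ((k : Fin 9), false) * M (y, !decide (((y : Fin 9) : ℕ) % 3 = 0)) ((k : Fin 9) + 1, true)) + -M' ((k : Fin 9), true) (x, decide (((x : Fin 9) : ℕ) % 3 = 0)) * (M (z, !decide (((z : Fin 9) : ℕ) % 3 = 0)) ((k : Fin 9) + 1, true) * M (y, !decide (((y : Fin 9) : ℕ) % 3 = 0)) ((k : Fin 9), true)) + M' ((k : Fin 9) + 1, false) (x, decide (((x : Fin 9) : ℕ) % 3 = 0)) * (M (z, !decide (((z : Fin 9) : ℕ) % 3 = 0)) ((k : Fin 9), true) * M (y, !decide (((y : Fin 9) : ℕ) % 3 = 0)) ((k : Fin 9), false))))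 = s * (if x = A ∧ y = B ∧ z = C then (1 : ℤ) else if x = C ∧ y = A ∧ z = B then (1 : ℤ) else if x = B ∧ y = A ∧ z = C then (-1 : ℤ) else if x = B ∧ y = C ∧ z = A then (1 : ℤ) else if x = A ∧ y = C ∧ z = B then (-1 : ℤ) else if x = C ∧ y = B ∧ z = A then (-1 : ℤ) else 0))
    (h₁ h₂ h₃ : Fin N) :
    (if decide (((h₁ : Fin N) : ℕ) % 3 = 0) then (-1 : ℤ) else 1) * ((E' ((Fin.castLE h9 k : Fin N), false) (h₁, decide (((h₁ : Fin N) : ℕ) % 3 = 0)) * (E (h₂, !decide (((h₂ : Fin N) : ℕ) % 3 = 0)) ((Fin.castLE h9 k : Fin N), false) * E (h₃, !decide (((h₃ : Fin N) : ℕ) % 3 = 0)) ((Fin.castLE h9 (k + 1) : Fin N), true)) + -E' ((Fin.castLE h9 k : Fin N), true) (h₁, decide (((h₁ : Fin N) : ℕ) % 3 = 0)) * (E (h₂, !decide (((h₂ : Fin N) : ℕ) % 3 = 0)) ((Fin.castLE h9 (k + 1) : Fin N), true) * E (h₃, !decide (((h₃ : Fin N) : ℕ) % 3 = 0)) ((Fin.castLE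 h9 k : Fin N), true)) + E' ((Fin.castLE h9 (k + 1) : Fin N), false) (h₁, decide (((h₁ : Fin N) : ℕ) % 3 = 0)) * (E (h₂, !decide (((h₂ : Fin N) : ℕ) % 3 = 0)) ((Fin.castLE h9 k : Fin N), true) * E (h₃, !decide (((h₃ : Fin N) : ℕ) % 3 = 0)) ((Fin.castLE h9 k : Fin N), false))) - (E' ((Fin.castLE h9 k : Fin N), false) (h₁, decide (((h₁ : Fin N) : ℕ) % 3 = 0)) * (E (h₃, !decide (((h₃ : Fin N) : ℕ) % 3 = 0)) ((Fin.castLE h9 k : Fin N), false) * E (h₂, !decide (((h₂ : Fin N) : ℕ) % 3 = 0)) ((Fin.castLE h9 (k + 1) : Fin N), true)) + -E' ((Fin.castLE h9 k : Fin N), true) (h₁, decide (((h₁ : Fin N) : ℕ) % 3 = 0)) * (E (h₃, !decide (((h₃ : Fin N) : ℕ) % 3 = 0)) ((Fin.castLE h9 (k + 1) : Fin N), true) * E (h₂, !decide (((h₂ : Fin N) : ℕ) % 3 = 0)) ((Fin.castLE h9 k : Fin N), true)) + E' ((Fin.castLE h9 (k + 1) : Fin N), false) (h₁, decide (((h₁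 : Fin N) : ℕ) % 3 = 0)) * (E (h₃, !decide (((h₃ : Fin N) : ℕ) % 3 = 0)) ((Fin.castLE h9 k : Fin N), true) * E (h₂, !decide (((h₂ : Fin N) : ℕ) % 3 = 0)) ((Fin.castLE h9 k : Fin N), false)))) = s * (if h₁ = Fin.castLE h9 A ∧ h₂ = Fin.castLE h9 B ∧ h₃ = Fin.castLE h9 C then (1 : ℤ) else if h₁ = Fin.castLE h9 C ∧ h₂ = Fin.castLE h9 A ∧ h₃ = Fin.castLE h9 B then (1 : ℤ) else if h₁ = Fin.castLE h9 B ∧ h₂ = Fin.castLE h9 A ∧ h₃ = Fin.castLE h9 C then (-1 : ℤ) else if h₁ = Fin.castLE h9 B ∧ h₂ = Fin.castLE h9 C ∧ h₃ = Fin.castLE h9 A then (1 : ℤ) else if h₁ = Fin.castLE h9 A ∧ h₂ = Fin.castLE h9 C ∧ h₃ = Fin.castLE h9 B then (-1 : ℤ) else if h₁ = Fin.castLE h9 C ∧ h₂ = Fin.castLE h9 B ∧ h₃ = Fin.castLE h9 A then (-1 : ℤ) else 0) := by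
  have hne : ∀ h : Fin N, 9 ≤ (h : ℕ) → ∀ X : Fin 9, h ≠ Fin.castLE h9 X := fun h hh X e => by
    have e' := congrArg Fin.val e
    rw [Fin.val_castLE] at e'
    have := X.2
    omega
  by_cases hall : (h₁ : ℕ) < 9 ∧ (h₂ : ℕ) < 9 ∧ (h₃ : ℕ) < 9
  · obtain ⟨hh₁, hh₂, hh₃⟩ := hall
    simp only [blockEmbed_cast_apply_of_lt h9 hE' _ _ _ h₁ hh₁, blockEmbed_apply_cast_of_lt h9 hE _ _ _ h₂ hh₂,
      blockEmbed_apply_cast_of_lt h9 hE _ _ _ h₃ hh₃]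
    simpa only [Fin.ext_iff, Fin.val_mk, Fin.val_castLE] using hR ⟨h₁, hh₁⟩ ⟨h₂, hh₂⟩ ⟨h₃, hh₃⟩
  · rw [not_and_or, not_and_or, not_lt, not_lt, not_lt] at hall
    rcases hall with hh | hh | hh
    · simp only [blockEmbed_cast_apply_of_ge h9 hE' _ _ _ h₁ hh, zero_mul, neg_zero, add_zero, sub_self, mul_zero,
        hne h₁ hh, false_and, if_false]
    · simp only [blockEmbed_apply_cast_of_ge h9 hE _ _ _ h₂ hh, zero_mul, mul_zero, add_zero, sub_self,
        hne h₂ hh, false_and, and_false, if_false]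
    · simp only [blockEmbed_apply_cast_of_ge h9 hE _ _ _ h₃ hh, zero_mul, mul_zero, add_zero, sub_self,
        hne h₃ hh, and_false, if_false]

omit h9 in
/-- Transport of the elementary alternating form along an injective relabelling of the handles. [folklore] -/
theorem etilde_perm (τ : Fin N → Fin N) (hτ : Function.Injective τ) {a b c A B C : Fin N}
    (ha : τ a = A) (hb : τ b = B) (hc : τ c = C) (j v w : Fin N) :
    (if τ j = A ∧ τ v = B ∧ τ w = C then (1 : ℤ) else if τ j = C ∧ τ v = A ∧ τ w = B then (1 : ℤ) else if τ j = B ∧ τ v = A ∧ τ w = C then (-1 : ℤ) else if τ j = B ∧ τ v = C ∧ τ w = A then (1 : ℤ) else if τ j = A ∧ τ v = C ∧ τ w = B then (-1 : ℤ) else if τ j = C ∧ τ v = B ∧ τ w = A then (-1 : ℤ) else 0) =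
      (if j = a ∧ v = b ∧ w = c then (1 : ℤ) else if j = c ∧ v = a ∧ w = b then (1 : ℤ) else if j = b ∧ v = a ∧ w = c then (-1 : ℤ) else if j = b ∧ v = c ∧ w = a then (1 : ℤ) else if j = a ∧ v = c ∧ w = b then (-1 : ℤ) else if j = c ∧ v = b ∧ w = a then (-1 : ℤ) else 0) := by
  subst ha hb hc
  simp only [hτ.eq_iff]

omit h9 in
/-- On `v < w` (and `a < b < c`) the full elementary alternating form is its three-term version. [folklore] -/
theorem etilde_eq_e3 {a b c j v w : Fin N} (hab : a < b) (hbc : b < c) (hvw : v < w) :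
    (if j = a ∧ v = b ∧ w = c then (1 : ℤ) else if j = c ∧ v = a ∧ w = b then (1 : ℤ) else if j = b ∧ v = a ∧ w = c then (-1 : ℤ) else if j = b ∧ v = c ∧ w = a then (1 : ℤ) else if j = a ∧ v = c ∧ w = b then (-1 : ℤ) else if j = c ∧ v = b ∧ w = a then (-1 : ℤ) else 0) =
      (if j = a ∧ v = b ∧ w = c then (1 : ℤ) else if j = c ∧ v = a ∧ w = b then (1 : ℤ) else if j = b ∧ v = a ∧ w = c then (-1 : ℤ) else 0) := by
  have h4 : ¬(j = b ∧ v = c ∧ w = a) := fun h => absurd hvw (by rw [h.2.1, h.2.2]; exact lt_asymm (hab.trans hbc))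
  have h5 : ¬(j = a ∧ v = c ∧ w = b) := fun h => absurd hvw (by rw [h.2.1, h.2.2]; exact lt_asymm hbc)
  have h6 : ¬(j = c ∧ v = b ∧ w = a) := fun h => absurd hvw (by rw [h.2.1, h.2.2]; exact lt_asymm hab)
  rw [if_neg h4, if_neg h5, if_neg h6]

end BlockReading

/-! ## §2 Elementary realisers at genus `3 + 3m` -/

section Elementary

variable {m : ℕ}

/-- **The elementary realiser of `± e_{abc}` from one base datum** (see the module docstring): for a genus-`9` base
matrix `M` (inverse `M'`) passing the decidable Goeritz checks, a seed handle `k ≤ 7`, a monomial `(A, B, C)` of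
distinct handles with `RD'_9(M, M', k) = s · ẽ_{ABC}`, and handles `a < b < c` of `Fin (3+3m)` (`3 + 3m ≥ 9`) with the
residues of `A, B, C`, some `y ∈ Stab N₀ ∩ Stab N₁` is IA and reads as a form `D` with `D = s · e_{abc}` on `v < w`.
[folklore] -/
theorem exists_elementary_realiser (h9 : 9 ≤ 3 + 3 * m) (M M' : Matrix (Fin 9 × Bool) (Fin 9 × Bool) ℤ)
    (k A B C : Fin 9) (s : ℤ) (h1 : M * M' = 1) (h2 : M' * M = 1)
    (hS : ∀ x y : Fin 9 × Bool, symplForm (fun q => M q x) (fun q => M q y) =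
      symplForm (Pi.single x (1 : ℤ) : Fin 9 × Bool → ℤ) (Pi.single y (1 : ℤ)))
    (h0 : ∀ i j : Fin 9, M (i, !decide ((i : ℕ) % 3 = 2)) (j, decide ((j : ℕ) % 3 = 2)) = 0)
    (h1' : ∀ i j : Fin 9, M (i, !decide ((i : ℕ) % 3 = 1)) (j, decide ((j : ℕ) % 3 = 1)) = 0)
    (hk : ((k : Fin 9) : ℕ) + 1 < 9) (hAB : A ≠ B) (hAC : A ≠ C) (hBC : B ≠ C)
    (hR : ∀ x y z : Fin 9, (if decide (((x : Fin 9) : ℕ) % 3 = 0) then (-1 : ℤ) else 1) * ((M' ((k : Fin 9), false) (x, decide (((x : Fin 9) : ℕ) % 3 = 0)) * (M (y, !decide (((y : Fin 9) : ℕ) % 3 = 0)) ((k : Fin 9), false) * M (z, !decide (((z : Fin 9) : ℕ) % 3 = 0)) ((k : Fin 9) + 1, true)) + -M' ((k : Fin 9), true) (x, decide (((x : Fin 9) : ℕ) % 3 = 0)) * (M (y, !decide (((y : Fin 9) : ℕ) % 3 = 0)) ((k : Fin 9) + 1, true) * M (z, !decide (((z : Fin 9) : ℕ) % 3 = 0))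 ((k : Fin 9), true)) + M' ((k : Fin 9) + 1, false) (x, decide (((x : Fin 9) : ℕ) % 3 = 0)) * (M (y, !decide (((y : Fin 9) : ℕ) % 3 = 0)) ((k : Fin 9), true) * M (z, !decide (((z : Fin 9) : ℕ) % 3 = 0)) ((k : Fin 9), false))) - (M' ((k : Fin 9), false) (x, decide (((x : Fin 9) : ℕ) % 3 = 0)) * (M (z, !decide (((z : Fin 9) : ℕ) % 3 = 0)) ((k : Fin 9), false) * M (y, !decide (((y : Fin 9) : ℕ) % 3 = 0)) ((k : Fin 9) + 1, true)) + -M' ((k : Fin 9), true) (x, decide (((x : Fin 9) : ℕ) % 3 = 0)) * (M (z, !decide (((z : Fin 9) : ℕ) % 3 = 0)) ((k : Fin 9) + 1, true) * M (y, !decide (((y : Fin 9) : ℕ) % 3 = 0)) ((k : Fin 9), true)) + M' ((k : Fin 9) + 1, false) (x, decide (((x : Fin 9) : ℕ) % 3 = 0)) * (M (z, !decide (((z : Fin 9) : ℕ) % 3 = 0)) ((k : Fin 9), true) * M (y, !decide (((y : Fin 9) : ℕ) % 3 = 0)) ((k : Fin 9), false)))) = s * (if x = A ∧ y = B ∧ z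 = C then (1 : ℤ) else if x = C ∧ y = A ∧ z = B then (1 : ℤ) else if x = B ∧ y = A ∧ z = C then (-1 : ℤ) else if x = B ∧ y = C ∧ z = A then (1 : ℤ) else if x = A ∧ y = C ∧ z = B then (-1 : ℤ) else if x = C ∧ y = B ∧ z = A then (-1 : ℤ) else 0))
    {π : SurfaceGroup (3 + 3 * m) →* FreeGroup (Fin (3 + 3 * m))} (hπs : Function.Surjective π)
    (hπof : ∀ (h : Fin (3 + 3 * m)) (b : Bool), π (PresentedGroup.of (h, b)) = if b = decide (((h : Fin (3 + 3 * m)) : ℕ) % 3 = 0) then 1 else FreeGroup.of h)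
    (a b c : Fin (3 + 3 * m)) (hab : a < b) (hbc : b < c)
    (ha : ((A : Fin 9) : ℕ) % 3 = ((a : Fin (3 + 3 * m)) : ℕ) % 3) (hb : ((B : Fin 9) : ℕ) % 3 = ((b : Fin (3 + 3 * m)) : ℕ) % 3)
    (hc : ((C : Fin 9) : ℕ) % 3 = ((c : Fin (3 + 3 * m)) : ℕ) % 3) :
    ∃ y : SurfaceGroup (3 + 3 * m) ≃* SurfaceGroup (3 + 3 * m), (s4Kernels.stabilizeIter m 0).map y.toMonoidHom = s4Kernels.stabilizeIter m 0 ∧ (s4Kernels.stabilizeIter m 1).map y.toMonoidHom = s4Kernels.stabilizeIter m 1 ∧ (∀ t : SurfaceGroup (3 + 3 * m), y t * t⁻¹ ∈ ((⊤ : Subgroup (SurfaceGroup (3 + 3 * m))).lowerCentralSeries 1)) ∧ ∃ D : Fin (3 + 3 * m) → Fin (3 + 3 * m) → Fin (3 + 3 * m) → ℤ, (∀ j : Fin (3 + 3 * m), π (y (PresentedGroup.of (j, decide (((j : Fin (3 + 3 * m)) : ℕ) % 3 = 0))) * (PresentedGroup.of (j, decide (((j : Fin (3 + 3 * m)) : ℕ)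 % 3 = 0)))⁻¹) * (((List.finRange (3 + 3 * m)).map (fun v => ((List.finRange (3 + 3 * m)).map (fun w => if v < w then ⁅(FreeGroup.of v : FreeGroup (Fin (3 + 3 * m))), FreeGroup.of w⁆ ^ ((if decide (((j : Fin (3 + 3 * m)) : ℕ) % 3 = 0) then (-1 : ℤ) else 1) * D j v w) else (1 : FreeGroup (Fin (3 + 3 * m))))).prod)).prod)⁻¹ ∈ ((⊤ : Subgroup (FreeGroup (Fin (3 + 3 * m)))).lowerCentralSeries 2)) ∧ ∀ j v w : Fin (3 + 3 * m), v < w → D j v w = s * (if j = a ∧ v = b ∧ w = c then (1 : ℤ) else if j = c ∧ v = a ∧ w = b then (1 : ℤ) else if j = b ∧ v = a ∧ w = c then (-1 : ℤ) else 0) := by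
  obtain ⟨E, hE⟩ : ∃ E : Matrix (Fin (3 + 3 * m) × Bool) (Fin (3 + 3 * m) × Bool) ℤ, ∀ p q : Fin (3 + 3 * m) × Bool, E p q =
      if hp : (p.1 : ℕ) < 9 then (if hq : (q.1 : ℕ) < 9 then M (⟨p.1, hp⟩, p.2) (⟨q.1, hq⟩, q.2) else 0)
      else (if p = q then 1 else 0) :=
    ⟨fun p q => if hp : (p.1 : ℕ) < 9 then (if hq : (q.1 : ℕ) < 9 then M (⟨p.1, hp⟩, p.2) (⟨q.1, hq⟩, q.2) else 0)
      else (if p = q then 1 else 0), fun _ _ => rfl⟩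
  obtain ⟨E', hE'⟩ : ∃ E' : Matrix (Fin (3 + 3 * m) × Bool) (Fin (3 + 3 * m) × Bool) ℤ, ∀ p q : Fin (3 + 3 * m) × Bool, E' p q =
      if hp : (p.1 : ℕ) < 9 then (if hq : (q.1 : ℕ) < 9 then M' (⟨p.1, hp⟩, p.2) (⟨q.1, hq⟩, q.2) else 0)
      else (if p = q then 1 else 0) :=
    ⟨fun p q => if hp : (p.1 : ℕ) < 9 then (if hq : (q.1 : ℕ) < 9 then M' (⟨p.1, hp⟩, p.2) (⟨q.1, hq⟩, q.2) else 0)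
      else (if p = q then 1 else 0), fun _ _ => rfl⟩
  have hcast : ∀ X : Fin 9, ((Fin.castLE h9 X : Fin (3 + 3 * m)) : ℕ) % 3 = ((X : Fin 9) : ℕ) % 3 := fun X => by
    rw [Fin.val_castLE]
  have hne9 : ∀ X Y : Fin 9, X ≠ Y → (Fin.castLE h9 X : Fin (3 + 3 * m)) ≠ Fin.castLE h9 Y := fun X Y h e =>
    h (Fin.castLE_injective h9 e)
  obtain ⟨τ, σ, hστ, hτσ, hres, hτa, hτb, hτc⟩ := exists_perm_three a b c (Fin.castLE h9 A) (Fin.castLE h9 B)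
    (Fin.castLE h9 C) hab.ne (hab.trans hbc).ne hbc.ne (hne9 _ _ hAB) (hne9 _ _ hAC) (hne9 _ _ hBC)
    (by rw [hcast, ha]) (by rw [hcast, hb]) (by rw [hcast, hc])
  obtain ⟨y, hy0, hy1, hyIA, hyD⟩ := exists_perm_conj_realiser_g (Fin.castLE h9 k) (Fin.castLE h9 (k + 1))
    (castLE_succ_mod h9 k hk) E E' 1 (Or.inl rfl) (blockEmbed_mul hE hE' h9 h1) (blockEmbed_mul hE' hE h9 h2)
    (blockEmbed_symplForm_col hE h9 hS) (blockEmbed_block hE 2 h0) (blockEmbed_block hE 1 h1') τ σ hστ hτσ hres hπs hπof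
  refine ⟨y, hy0, hy1, hyIA, _, hyD, fun j v w hvw => ?_⟩
  rw [← hres j, ← hres v, ← hres w, reading_blockEmbed h9 hE hE' k A B C s hR (τ j) (τ v) (τ w),
    etilde_perm τ (fun x x' e => by rw [← hστ x, e, hστ]) hτa hτb hτc, etilde_eq_e3 hab hbc hvw]

/-- **Elementary realisers from a table indexed by residue patterns** (the format consumed by the genus-`(3+3m)`
assembly): base matrices `Mb t` (inverses `Mbi t`, seed handles `kb t`), and for every residue pattern
`(r, s, u)` a type `typ r s u`, a monomial `(At, Bt, Ct) r s u` with these residues and a sign `sg r s u` such that the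
un-permuted collapsed genus-`9` reading of type `typ r s u` is `sg r s u · ẽ_{At Bt Ct}` — all decidable on literal
tables.  THEN for all handles `a, b, c` of `Fin (3+3m)` (`3 + 3m ≥ 9`) some `y ∈ Stab N₀ ∩ Stab N₁` is IA and reads as a
form `D` which, if `a < b < c` is an allowed triple, is `± e_{abc}` on `v < w` (else `y = 1`, `D = 0`). [folklore] -/
theorem exists_elementary_realiser_tab (h9 : 9 ≤ 3 + 3 * m) {κ : Type}
    (Mb Mbi : κ → Matrix (Fin 9 × Bool) (Fin 9 × Bool) ℤ) (kb : κ → Fin 9) (typ : Fin 3 → Fin 3 → Fin 3 → κ)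
    (At Bt Ct : Fin 3 → Fin 3 → Fin 3 → Fin 9) (sg : Fin 3 → Fin 3 → Fin 3 → ℤ)
    (hinv : ∀ t, Mb t * Mbi t = 1) (hinv' : ∀ t, Mbi t * Mb t = 1)
    (hS : ∀ t (x y : Fin 9 × Bool), symplForm (fun q => Mb t q x) (fun q => Mb t q y) =
      symplForm (Pi.single x (1 : ℤ) : Fin 9 × Bool → ℤ) (Pi.single y (1 : ℤ)))
    (h0 : ∀ t (i j : Fin 9), Mb t (i, !decide ((i : ℕ) % 3 = 2)) (j, decide ((j : ℕ) % 3 = 2)) = 0)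
    (h1 : ∀ t (i j : Fin 9), Mb t (i, !decide ((i : ℕ) % 3 = 1)) (j, decide ((j : ℕ) % 3 = 1)) = 0)
    (hk : ∀ t, ((kb t : Fin 9) : ℕ) + 1 < 9)
    (htab : ∀ r s u : Fin 3, ¬(r = 1 ∧ s = 1 ∧ u = 1) → ¬(r = 2 ∧ s = 2 ∧ u = 2) →
      (((At r s u : Fin 9) : ℕ) % 3 = ((r : Fin 3) : ℕ) ∧ ((Bt r s u : Fin 9) : ℕ) % 3 = ((s : Fin 3) : ℕ) ∧
        ((Ct r s u : Fin 9) : ℕ) % 3 = ((u : Fin 3) : ℕ) ∧ At r s u ≠ Bt r s u ∧ At r s u ≠ Ct r s u ∧ Bt r s u ≠ Ct r s u ∧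
        (sg r s u = 1 ∨ sg r s u = -1)))
    (hR : ∀ r s u : Fin 3, ¬(r = 1 ∧ s = 1 ∧ u = 1) → ¬(r = 2 ∧ s = 2 ∧ u = 2) →
      ∀ x y z : Fin 9, (if decide (((x : Fin 9) : ℕ) % 3 = 0) then (-1 : ℤ) else 1) * ((Mbi (typ r s u) ((kb (typ r s u) : Fin 9), false) (x, decide (((x : Fin 9) : ℕ) % 3 = 0)) * (Mb (typ r s u) (y, !decide (((y : Fin 9) : ℕ) % 3 = 0)) ((kb (typ r s u) : Fin 9), false) * Mb (typ r s u) (z, !decide (((z : Fin 9) : ℕ) % 3 = 0)) ((kb (typ r s u) : Fin 9) + 1, true)) + -Mbi (typ r s u) ((kb (typ r s u) : Fin 9), true) (x, decide (((x : Fin 9) : ℕ) % 3 = 0)) * (Mb (typ r s u) (y, !decide (((y : Fin 9) : ℕ) % 3 = 0)) ((kb (typ r s u) : Fin 9) + 1, true) * Mb (typ r s u) (z, !decide (((z : Fin 9) : ℕ) % 3 = 0)) ((kb (typ r s u) : Fin 9), true)) + Mbi (typ r s u) ((kb (typ r s u) : Fin 9) + 1, false) (x, decide (((x : Fin 9) :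 ℕ) % 3 = 0)) * (Mb (typ r s u) (y, !decide (((y : Fin 9) : ℕ) % 3 = 0)) ((kb (typ r s u) : Fin 9), true) * Mb (typ r s u) (z, !decide (((z : Fin 9) : ℕ) % 3 = 0)) ((kb (typ r s u) : Fin 9), false))) - (Mbi (typ r s u) ((kb (typ r s u) : Fin 9), false) (x, decide (((x : Fin 9) : ℕ) % 3 = 0)) * (Mb (typ r s u) (z, !decide (((z : Fin 9) : ℕ) % 3 = 0)) ((kb (typ r s u) : Fin 9), false) * Mb (typ r s u) (y, !decide (((y : Fin 9) : ℕ) % 3 = 0)) ((kb (typ r s u) : Fin 9) + 1, true)) + -Mbi (typ r s u) ((kb (typ r s u) : Fin 9), true) (x, decide (((x : Fin 9) : ℕ) % 3 = 0)) * (Mb (typ r s u) (z, !decide (((z : Fin 9) : ℕ) % 3 = 0)) ((kb (typ r s u) : Fin 9) + 1, true) * Mb (typ r s u) (y, !decide (((y : Fin 9) : ℕ) % 3 = 0)) ((kb (typ r s u) : Fin 9), true)) + Mbi (typ r s u) ((kb (typ r s u) : Fin 9) + 1, false) (x, decide (((x : Fin 9) : ℕ) % 3 = 0)) * (Mb (typ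 r s u) (z, !decide (((z : Fin 9) : ℕ) % 3 = 0)) ((kb (typ r s u) : Fin 9), true) * Mb (typ r s u) (y, !decide (((y : Fin 9) : ℕ) % 3 = 0)) ((kb (typ r s u) : Fin 9), false)))) = sg r s u * (if x = At r s u ∧ y = Bt r s u ∧ z = Ct r s u then (1 : ℤ) else if x = Ct r s u ∧ y = At r s u ∧ z = Bt r s u then (1 : ℤ) else if x = Bt r s u ∧ y = At r s u ∧ z = Ct r s u then (-1 : ℤ) else if x = Bt r s u ∧ y = Ct r s u ∧ z = At r s u then (1 : ℤ) else if x = At r s u ∧ y = Ct r s u ∧ z = Bt r s u then (-1 : ℤ) else if x = Ct r s u ∧ y = Bt r s u ∧ z = At r s u then (-1 : ℤ) else 0))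
    {π : SurfaceGroup (3 + 3 * m) →* FreeGroup (Fin (3 + 3 * m))} (hπs : Function.Surjective π)
    (hπof : ∀ (h : Fin (3 + 3 * m)) (b : Bool), π (PresentedGroup.of (h, b)) = if b = decide (((h : Fin (3 + 3 * m)) : ℕ) % 3 = 0) then 1 else FreeGroup.of h)
    (a b c : Fin (3 + 3 * m)) :
    ∃ y : SurfaceGroup (3 + 3 * m) ≃* SurfaceGroup (3 + 3 * m), (s4Kernels.stabilizeIter m 0).map y.toMonoidHom = s4Kernels.stabilizeIter m 0 ∧ (s4Kernels.stabilizeIter m 1).map y.toMonoidHom = s4Kernels.stabilizeIter m 1 ∧ (∀ t : SurfaceGroup (3 + 3 * m), y t * t⁻¹ ∈ ((⊤ : Subgroup (SurfaceGroup (3 + 3 * m))).lowerCentralSeries 1)) ∧ ∃ (D : Fin (3 + 3 * m) → Fin (3 + 3 * m) → Fin (3 + 3 * m) → ℤ) (s : ℤ), (s = 1 ∨ s = -1) ∧ (∀ j : Fin (3 + 3 * m), π (y (PresentedGroup.of (j, decide (((j : Fin (3 + 3 * m)) : ℕ) % 3 = 0))) * (PresentedGroup.of (j, decide (((j : Fin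 (3 + 3 * m)) : ℕ) % 3 = 0)))⁻¹) * (((List.finRange (3 + 3 * m)).map (fun v => ((List.finRange (3 + 3 * m)).map (fun w => if v < w then ⁅(FreeGroup.of v : FreeGroup (Fin (3 + 3 * m))), FreeGroup.of w⁆ ^ ((if decide (((j : Fin (3 + 3 * m)) : ℕ) % 3 = 0) then (-1 : ℤ) else 1) * D j v w) else (1 : FreeGroup (Fin (3 + 3 * m))))).prod)).prod)⁻¹ ∈ ((⊤ : Subgroup (FreeGroup (Fin (3 + 3 * m)))).lowerCentralSeries 2)) ∧ ((a < b) → (b < c) → ¬((((a : Fin (3 + 3 * m)) : ℕ) % 3 = 1) ∧ (((b : Fin (3 + 3 * m)) : ℕ) % 3 = 1) ∧ (((c : Fin (3 + 3 * m)) : ℕ) % 3 = 1)) → ¬((((a : Fin (3 + 3 * m)) : ℕ) % 3 = 2) ∧ (((b : Fin (3 + 3 * m)) : ℕ) % 3 = 2) ∧ (((c : Fin (3 + 3 * m)) : ℕ) % 3 = 2)) → ∀ j v w : Fin (3 + 3 * m), v < w → D j v w = s * (if j = a ∧ v = b ∧ w = c then (1 : ℤ) else if j = c ∧ v = a ∧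 w = b then (1 : ℤ) else if j = b ∧ v = a ∧ w = c then (-1 : ℤ) else 0)) := by
  by_cases hall : a < b ∧ b < c ∧
      ¬((((a : Fin (3 + 3 * m)) : ℕ) % 3 = 1) ∧ (((b : Fin (3 + 3 * m)) : ℕ) % 3 = 1) ∧ (((c : Fin (3 + 3 * m)) : ℕ) % 3 = 1)) ∧
      ¬((((a : Fin (3 + 3 * m)) : ℕ) % 3 = 2) ∧ (((b : Fin (3 + 3 * m)) : ℕ) % 3 = 2) ∧ (((c : Fin (3 + 3 * m)) : ℕ) % 3 = 2))
  · obtain ⟨hab, hbc, hn1, hn2⟩ := hall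
    obtain ⟨r, hr⟩ : ∃ r : Fin 3, ((r : Fin 3) : ℕ) = ((a : Fin (3 + 3 * m)) : ℕ) % 3 := ⟨⟨_, Nat.mod_lt _ (by decide)⟩, rfl⟩
    obtain ⟨s, hs⟩ : ∃ s : Fin 3, ((s : Fin 3) : ℕ) = ((b : Fin (3 + 3 * m)) : ℕ) % 3 := ⟨⟨_, Nat.mod_lt _ (by decide)⟩, rfl⟩
    obtain ⟨u, hu⟩ : ∃ u : Fin 3, ((u : Fin 3) : ℕ) = ((c : Fin (3 + 3 * m)) : ℕ) % 3 := ⟨⟨_, Nat.mod_lt _ (by decide)⟩, rfl⟩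
    have hr1 : ¬(r = 1 ∧ s = 1 ∧ u = 1) := fun h => hn1
      ⟨by rw [← hr, h.1]; rfl, by rw [← hs, h.2.1]; rfl, by rw [← hu, h.2.2]; rfl⟩
    have hr2 : ¬(r = 2 ∧ s = 2 ∧ u = 2) := fun h => hn2
      ⟨by rw [← hr, h.1]; rfl, by rw [← hs, h.2.1]; rfl, by rw [← hu, h.2.2]; rfl⟩
    obtain ⟨hA, hB, hC, hAB, hAC, hBC, hsg⟩ := htab r s u hr1 hr2
    obtain ⟨y, hy0, hy1, hyIA, D, hD, hcert⟩ := exists_elementary_realiser h9 (Mb (typ r s u)) (Mbi (typ r s u))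
      (kb (typ r s u)) (At r s u) (Bt r s u) (Ct r s u) (sg r s u) (hinv _) (hinv' _) (hS _) (h0 _) (h1 _) (hk _)
      hAB hAC hBC (hR r s u hr1 hr2) hπs hπof a b c hab hbc (hA.trans hr) (hB.trans hs) (hC.trans hu)
    exact ⟨y, hy0, hy1, hyIA, D, sg r s u, hsg, hD, fun _ _ _ _ => hcert⟩
  · refine ⟨MulEquiv.refl _, ?_, ?_, fun t => ?_, fun _ _ _ => 0, 1, Or.inl rfl, fun j => ?_,
      fun h₁ h₂ h₃ h₄ => (hall ⟨h₁, h₂, h₃, h₄⟩).elim⟩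
    · exact Subgroup.map_id _
    · exact Subgroup.map_id _
    · rw [MulEquiv.refl_apply, mul_inv_cancel]; exact one_mem _
    · simp only [mul_zero]
      rw [pp_zero_exp, MulEquiv.refl_apply, mul_inv_cancel, map_one, inv_one, mul_one]
      exact one_mem _

end Elementary

/-! ## Registered helper -/

/-- **Registered helper `helper_etildePerm`** (sub-goal of stub `stub_layerStepBlockZero`, crux stmt-SmoothPoincare4-14595;
the file's main theorems exceed the registry's signature size): transport of the elementary alternating form along an
injective relabelling of the handles. [folklore] -/
theorem helper_etildePerm : ∀ (N : ℕ) (τ : Fin N → Fin N), Function.Injective τ → ∀ (a b c A B C : Fin N), τ a = A → τ b = B → τ c = C → ∀ (j v w : Fin N), (if τ j = A ∧ τ v = B ∧ τ w = C then (1 : ℤ) else if τ j = C ∧ τ v = A ∧ τ w = B then (1 : ℤ) else if τ j = B ∧ τ v = A ∧ τ w = C then (-1 : ℤ) else if τ j = B ∧ τ v = C ∧ τ w = A then (1 : ℤ) else if τ j = A ∧ τ v = C ∧ τ w = B then (-1 : ℤ) else if τ j = C ∧ τ v = B ∧ τ w = A then (-1 : ℤ) else 0) = (if j = a ∧ v =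 b ∧ w = c then (1 : ℤ) else if j = c ∧ v = a ∧ w = b then (1 : ℤ) else if j = b ∧ v = a ∧ w = c then (-1 : ℤ) else if j = b ∧ v = c ∧ w = a then (1 : ℤ) else if j = a ∧ v = c ∧ w = b then (-1 : ℤ) else if j = c ∧ v = b ∧ w = a then (-1 : ℤ) else 0) :=
  fun _ τ hτ _ _ _ _ _ _ ha hb hc j v w => etilde_perm τ hτ ha hb hc j v w

end Summit.SmoothPoincare4.SmoothPoincare4.Theorems.ShadowApproximation.NilpotentGenusClass

end
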